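import Mathlib
import Summits.Ventures.HodgeRepro2.T6NAut3
import Summits.Ventures.HodgeRepro2.T6N2Contract
import Summits.Ventures.HodgeRepro2.T6N2ToyIsoS

/-!
# T6N2Contract3 — N2's M2 wrappers STATED NATIVELY OVER THE RE-CUT CARRIER `NAut3` (owner t6-p5;
TARGET-T6 v0.6 §9.2(b) v3 — t6-lead STATUS l. 11255 (3), T6NAut3 p406934)

The lead's v3 carrier `NAut3 F P` (T6NAut3) keeps the N2 datum `d2` of the v2 carrier verbatim and
re-cuts only the richness field (`data_adm'` in place of `data_adm`). N2's conclusion for the carrier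
is `NAut3.AdmDatum := M.d2.Adm`, the same sentence as on v2, so N2's two M2 wrappers — T6N2Contract's
`N2_main` (through the Shimura 2008 Thm 2.2(i) display) and T6N2ToyIso's `N2_main_explicit` (the
display-free form for datums of the explicit shape) — read the same over v3. The lead's M2 v6
(`periodInputN_of_published₆`, T6PeriodInput6) consumes `N2_main_explicit` on the forgetful v2 view
`M.toNAut2' hex` (T6NAut3View); this file states both wrappers NATIVELY on `M : NAut3 F P`, with no
view and no `hex` (the N2 block of the composition never needed the richness), exactly as t6-p3's
`N3iso_main₃` does for N3 (T6N3Main3):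

* `N2_main₃ M hfr h₁₁₁ h₁₀₀ hu hSh : M.AdmDatum` (the display route — `N2Main.adm_of` on `M.d2`);
* `N2_main_explicit₃ M hfr h₁₁₁ hm he : M.AdmDatum` (display-free — `adm_of_explicit` on `M.d2`);
* `ExplicitShape M` = the conjunction of the four explicit-shape binders (one `def … : Prop` of the
  EX class, NOT a display), with `N2_main_explicitShape₃ M (h : ExplicitShape M) : M.AdmDatum` — the
  one-binder bundle a revision of the composition may take in place of `hfr h₁₁₁ hm he`;
* the transport along the lead's maps: `ofNAut2_N2_main_explicit₃` (`N2_main_explicit` on a v2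
  carrier gives `AdmDatum` of its v3 image), `ofNAut_toyIsoSF_admDatum₃` / `ofNAut_toyIsoSF_explicitShape₃`
  (a v1 carrier with the explicit-isometry datum `toyIsoSF` adjoined — ANY admissible sets, so
  ℚ-rational ones — is a v3 carrier with N2's conclusion and the explicit shape, no hypothesis) and
  `ofNAut2_toyIsoSF_admDatum₃` (a v2 carrier whose `d2` is `toyIsoSF …`, mapped to v3).

Nothing here is new mathematics: every proof is the v2 theorem applied to the v3 carrier's `d2`
(the fields `d2`, `d3` of `NAut3.ofNAut` / `ofNAut2` are the originals by `rfl`).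

README §8(d): uses an L-value-free non-vanishing device: NO (TIER5 §N2, a pre-02:16Z line of
record — N2 asserts no non-vanishing — continued).
-/

namespace Summit.Ventures.HodgeRepro2.T6.N2Contract3

open Summit.Ventures.HodgeRepro2
open Summit.Ventures.HodgeRepro2.T6
open Summit.Ventures.HodgeRepro2.T5DatumSimilitude
open Summit.Ventures.HodgeRepro2.T5CubeTypes
open Summit.Ventures.HodgeRepro2.T6.N2ToyIso
open Summit.Ventures.HodgeRepro2.T6.N2ToyIsoS

variable {K : Type*} [Field K] [NumberField K] [NumberField.IsCMField K]

/-! ### The two wrappers, natively over `NAut3` -/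

/-- `N2_main` over the RE-CUT carrier (TARGET-T6 §9.3 at v3): N2's datum-level conclusion
`M.AdmDatum` — μ-admissibility of the four `ε_i`, `W_B ≅ W_A`, (H_χ) — from the display and the
datum's (N0.3)(b) properties, stated on `M : NAut3 F P` with no view. -/
theorem N2_main₃ {F : FaceSetting K} {P : NDatum F} (M : NAut3 F P)
    (hfr : IsCMFrame M.d2.τ)
    (h₁₁₁ : IsLiuSignElement K (M.d2.type t111) M.d2.e₁₁₁)
    (h₁₀₀ : IsLiuSignElement K (M.d2.type t100) M.d2.e₁₀₀)
    -- [residual: EX; the similitude scalar of (N0.3)(b), signs (+, −, +) — p3's `lemma_N2_datum`]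
    (hu : N2Main.USpec M.d2)
    (hSh : Hyp.Shimura2008_Thm2_2_i K) : M.AdmDatum :=
  N2Main.adm_of M.d2 hfr h₁₁₁ h₁₀₀ hu hSh

/-- `N2_main_explicit` over the RE-CUT carrier: `M.AdmDatum` WITHOUT the display for a datum of the
explicit shape (a CM frame, a μ-admissible `e₁₁₁`, the magnitudes `MagSpec` of `u`, and
`e₁₀₀ = u (1 − u) e₁₁₁`) — the N2 block of `periodInputN_of_mains₃` with no view and no `hex`. -/
theorem N2_main_explicit₃ {F : FaceSetting K} {P : NDatum F} (M : NAut3 F P)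
    (hfr : IsCMFrame M.d2.τ) (h₁₁₁ : IsLiuSignElement K (M.d2.type t111) M.d2.e₁₁₁)
    (hm : MagSpec M.d2.τ M.d2.u) (he : M.d2.e₁₀₀ = M.d2.u * (1 - M.d2.u) * M.d2.e₁₁₁) :
    M.AdmDatum :=
  adm_of_explicit M.d2 hfr h₁₁₁ hm he

/-! ### The explicit shape as one binder -/

/-- THE EXPLICIT SHAPE OF THE CARRIER'S N2 DATUM, as one sentence: the four binders
`hfr h₁₁₁ hm he` of `N2_main_explicit` (all of residual class EX — TIER5 (N2-b): «THIS is the datum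
N0 states once»). One `def … : Prop` on the carrier; NOT a display. -/
def ExplicitShape {F : FaceSetting K} {P : NDatum F} (M : NAut3 F P) : Prop :=
  IsCMFrame M.d2.τ ∧ IsLiuSignElement K (M.d2.type t111) M.d2.e₁₁₁ ∧
    MagSpec M.d2.τ M.d2.u ∧ M.d2.e₁₀₀ = M.d2.u * (1 - M.d2.u) * M.d2.e₁₁₁

/-- `N2_main_explicit₃` with the four binders bundled. -/
theorem N2_main_explicitShape₃ {F : FaceSetting K} {P : NDatum F} (M : NAut3 F P)
    (h : ExplicitShape M) : M.AdmDatum :=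
  N2_main_explicit₃ M h.1 h.2.1 h.2.2.1 h.2.2.2

/-- The bundle is the conjunction of the four binders (`Iff.rfl`). -/
theorem explicitShape_iff {F : FaceSetting K} {P : NDatum F} (M : NAut3 F P) :
    ExplicitShape M ↔
      IsCMFrame M.d2.τ ∧ IsLiuSignElement K (M.d2.type t111) M.d2.e₁₁₁ ∧
        MagSpec M.d2.τ M.d2.u ∧ M.d2.e₁₀₀ = M.d2.u * (1 - M.d2.u) * M.d2.e₁₁₁ :=
  Iff.rfl

/-! ### Transport along the lead's maps `NAut3.ofNAut` / `NAut3.ofNAut2` -/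

/-- `N2_main_explicit` on a v2 carrier gives N2's conclusion on its v3 image (`ofNAut2` keeps `d2`). -/
theorem ofNAut2_N2_main_explicit₃ {F : FaceSetting K} {P : NDatum F} (M₂ : NAut2 F P)
    (hfr : IsCMFrame M₂.d2.τ) (h₁₁₁ : IsLiuSignElement K (M₂.d2.type t111) M₂.d2.e₁₁₁)
    (hm : MagSpec M₂.d2.τ M₂.d2.u) (he : M₂.d2.e₁₀₀ = M₂.d2.u * (1 - M₂.d2.u) * M₂.d2.e₁₁₁) :
    (NAut3.ofNAut2 M₂).AdmDatum :=
  (NAut3.ofNAut2_admDatum M₂).2 (N2_main_explicit M₂ hfr h₁₁₁ hm he)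

/-- THE N2 BLOCK ON ANY v1 CARRIER LIFTED TO v3 WITH PRESCRIBED ADMISSIBLE SETS:
`NAut3.ofNAut M₁ (toyIsoSF …)` has `AdmDatum` with no hypothesis, whatever the sets — so the
joint toy over the re-cut carrier may take the ℚ-RATIONAL admissible sets of the host's reading
(STATUS l. 11271 (2)) and N2's binder is already discharged. -/
theorem ofNAut_toyIsoSF_admDatum₃ {F : FaceSetting K} {P : NDatum F} (M₁ : NAut F P)
    (admA : Set M₁.d3.A.Sa) (admB : Set M₁.d3.A.Sb) (admC : Set M₁.d3.B.Sa)
    (admD : Set M₁.d3.B.Sb) :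
    (NAut3.ofNAut M₁ (toyIsoSF F P M₁.d3 admA admB admC admD)).AdmDatum :=
  toyIsoSF_adm F P M₁.d3 admA admB admC admD

/-- The same carrier has the explicit shape (the four EX binders of `N2_main_explicit₃` at once). -/
theorem ofNAut_toyIsoSF_explicitShape₃ {F : FaceSetting K} {P : NDatum F} (M₁ : NAut F P)
    (admA : Set M₁.d3.A.Sa) (admB : Set M₁.d3.A.Sb) (admC : Set M₁.d3.B.Sa)
    (admD : Set M₁.d3.B.Sb) :
    ExplicitShape (NAut3.ofNAut M₁ (toyIsoSF F P M₁.d3 admA admB admC admD)) :=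
  toyIsoSF_explicitShape F P M₁.d3 admA admB admC admD

/-- A v2 carrier whose N2 datum is `toyIsoSF …` (any sets) has, as a v3 carrier, N2's conclusion
with no hypothesis. -/
theorem ofNAut2_toyIsoSF_admDatum₃ {F : FaceSetting K} {P : NDatum F} (M₂ : NAut2 F P)
    (admA : Set M₂.d3.A.Sa) (admB : Set M₂.d3.A.Sb) (admC : Set M₂.d3.B.Sa)
    (admD : Set M₂.d3.B.Sb)
    (hd2 : M₂.d2 = toyIsoSF F P M₂.d3 admA admB admC admD) :
    (NAut3.ofNAut2 M₂).AdmDatum := by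
  show M₂.d2.Adm
  rw [hd2]
  exact toyIsoSF_adm F P M₂.d3 admA admB admC admD

/-- `ofNAut` keeps N2's admissible quadruples: `AdmData` of the lifted carrier is membership in
the four prescribed sets. -/
theorem ofNAut_toyIsoSF_admData_iff₃ {F : FaceSetting K} {P : NDatum F} (M₁ : NAut F P)
    (admA : Set M₁.d3.A.Sa) (admB : Set M₁.d3.A.Sb) (admC : Set M₁.d3.B.Sa)
    (admD : Set M₁.d3.B.Sb) (φ : M₁.d3.A.Sa × M₁.d3.A.Sb × M₁.d3.B.Sa × M₁.d3.B.Sb) :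
    (NAut3.ofNAut M₁ (toyIsoSF F P M₁.d3 admA admB admC admD)).AdmData φ ↔
      φ.1 ∈ admA ∧ φ.2.1 ∈ admB ∧ φ.2.2.1 ∈ admC ∧ φ.2.2.2 ∈ admD :=
  Iff.rfl

end Summit.Ventures.HodgeRepro2.T6.N2Contract3
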